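import Summits.ResolutionOfSingularities.ResolutionOfSingularities.Theorems.EquisingularLiftEquisingularLiftNatDirLiftFrameHelpers
import Summits.ResolutionOfSingularities.ResolutionOfSingularities.Theorems.EquisingularLiftEquisingularLiftNatDirLiftRingCores
import Literature.AlgebraicGeometry.Modules.PullbackAffineChart
import HarnessLib

/-!
# [OURS · L1 W4.5(b) · EL♮(3)] T-DIRLIFT-UP (the direction-lift socket `hL` of the door at `n = 3`), brick (C3-iv):
# THE LIFTED COLUMN REDUCES TO THE DOWNSTAIRS DIRECTION

Crux chain w45b (cell `res-hironaka`, slot W4.5(b)), working crux **EL♮** = stmt-ResolutionOfSingularities-20038, child **EL♮(3)** =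
stmt-ResolutionOfSingularities-20148, route EquisingularLift, line `sections`. Object (L) = the `hL` socket of the PLUG p579941 /
p584312 (`stub_elnat_coneTowerPointResolution_three_of_lift (p) (hF102) (hL)`), skeleton `L/res-L1-w45b-stub-4/DirLiftSkeleton-v3.lean`
(res-L1-w45b-stub-4 g9, hand of record by the desk word 2026-08-27T23:09:59Z); this file is brick **(C3-iv)** of its C3⁺ part.
HONEST FRAMING: OURS; NOT a statement of any manuscript; AI-written, weaker than expert review. No `sorry`; standard axioms; DEF-FREE.
`--supports stmt-ResolutionOfSingularities-20148 --as helper`.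

WHAT. Upstairs: `X₀` with the in-carrier curve `V(I)`, `e : V(I) ≅ Y` (`Y = ℙ¹_O` in the assembly), the conormal bundle
`F := e.inv^* 𝒞` and a sub-line `σ : K ⟶ F` (T-P1VB's lift); downstairs: the special fibre `j₀ : G₀ → X₀`, `ψ : Y' ≅ V(I·𝒪_{G₀})` over `g : Y' → Y`
(`hψ`), the direction `𝒟'` (`Ī·Ī ≤ 𝒟'`), C1c's direction sections `w p` with their DICTIONARY (chart `(V_p, x^p, s^p)`, affine `W_p ∋ ψ p`,
coordinates `α`, `𝒟'(W_p) = (Σ α_j j₀♯x^p_j) + Ī(W_p)²`), the line `ι₀ : L₀ ↪ g^*F` they generate (`hι₀`: a rank-one frame of `L₀` over `U p` whose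
basis section `ι₀` sends to a UNIT multiple of `w p`), and the compatibility `g^*σ = e'⁻¹ ≫ ι₀`. A PACKAGE at a point (the output of (C3-ii)):
a conormal chart `(V, x, s, eV)`, lifted coordinates `A_j ∈ Γ(X₀, V)` and a rank-one frame `κ` of `K` over `W ⊇ e.inv⁻¹ι⁻¹V` with
`σ(κ₀)| = Σ_j e.inv♯ι♯A_j • b_j` (`hlink`). THEN (`dirLift_chartColumn_reduction`) at every `z ∈ G₀` with `j₀ z ∈ V`:
`𝒟'_z = ((j₀♯ Σ_j A_j x_j)_z) + Ī_z²` — the chart section `c := Σ A_j x_j` of the lifted column REDUCES to the downstairs direction.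

PROOF (three pullbacks deep, res-D-pv-051's B7 style). Off `supp Ī` both sides are `⊤`. At `z = (ψ ≫ ι_Ī) p`: (d) `η_g(σ κ₀) = ι₀(e'⁻¹ η_g κ₀)`
(`pullback_map_app_unitSection` + `hσ`), and `e'⁻¹ η_g κ₀` is the basis section of the rank-one frame `g^*κ ≫ e'⁻¹` of `L₀`; (e) on
`U p ⊓ g⁻¹W` two rank-one frames differ by a unit (`isUnit_coord_of_frames`), so `η_g(σ κ₀)| = λ • (w p)|` with `λ` a UNIT; (f)–(h) expand
both sides in the pulled-back conormal frame of the package chart over the preimage `B′ = (ψ ≫ ι_Ī)⁻¹W′` of a small affine `W′ ∋ z`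
(`exists_affineOpen_preimage_le`; change of generators `x^p = N x` on a common affine `V″`, `map_basisSection_eq_sum_of_changeOfGenerators`,
`map_unitSection_eq_sum`), and compare coefficients (`coord_sum_smul_basisSection`): `g♯e.inv♯ι♯A_m = λ · Σ_j ψ♯ι_Ī♯α_j · g♯e.inv♯ι♯N_jm`;
(j) descend along `(ψ ≫ ι_Ī)♯ : Γ(G₀, W′) ↠ Γ(Y′, B′)` (kernel `Ī(W′)`, `mem_ideal_of_appLE_comp_subschemeι_eq_zero`; `hψ`): `j₀♯A_m ≡ λ̃ Σ_j α_j j₀♯N_jm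
(mod Ī)` with `λ̃ λ̃′ ≡ 1 (mod Ī)`; (k) hence `j₀♯c ≡ λ̃ · Σ_j α_j j₀♯x^p_j (mod Ī·Ī)` (res-D-pv-036's ring cores p584571) and at the stalk `λ̃_z` is a
unit (`Ī_z ⊆ 𝔪_z`). One `maxHeartbeats 400000` (the restriction calculus is slow but convergent).

References (method / index only): R. Hartshorne, *Algebraic Geometry* (1977), II.5 (p. 110: `f^*` on sections), II Ex. 1.22 (glueing);
res-D-pv-051 …NatDirectionSections (C1c) / …NatDirectionChartData / …NatDirectionTransport; res-D-pv-036 …NatDirLiftRingCores (p584571).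
-/

set_option linter.dupNamespace false

noncomputable section

open CategoryTheory CategoryTheory.Limits AlgebraicGeometry TopologicalSpace Topology IsLocalRing Opposite
open Literature.AlgebraicGeometry.Resolution
open Literature.AlgebraicGeometry.Modules Literature.AlgebraicGeometry.Motives
open Literature.AlgebraicGeometry.Deformation Literature.AlgebraicGeometry.HodgeTheory
open AlgebraicGeometry.Scheme.IdealSheafData

namespace Summit.ResolutionOfSingularities.ResolutionOfSingularities.Cruxes.EquisingularLiftNat.Sections

open Summit.ResolutionOfSingularities.ResolutionOfSingularities.Cruxes.EquisingularLiftNat.P1VB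

universe u

/-! ## (C3-iv) -/

set_option maxHeartbeats 400000 in -- long `Scheme.Modules` restriction calculus (three pullbacks); several `isDefEq`s are slow but convergent
/-- **(C3-iv) — the lifted column reduces to the downstairs direction.** See the module docstring: at every `z ∈ G₀` with `j₀ z` in the
package chart `V`, `stalkIdeal 𝒟' z = span{(j₀♯ Σ_j A_j x_j)_z} ⊔ (stalkIdeal (I·𝒪_{G₀}) z)²`. [cite: Hartshorne1977, II.5 (p. 110)]
[OURS · L1 W4.5b · T-DIRLIFT-UP (L) brick (C3-iv)] toward `stub_elnat_coneTowerPointResolution` (stmt-ResolutionOfSingularities-20148);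
NOT a statement of the manuscript. -/
theorem dirLift_chartColumn_reduction {X₀ G₀ Y Y' : Scheme.{0}} (j₀ : G₀ ⟶ X₀) [IsLocallyNoetherian X₀] [IsLocallyNoetherian G₀]
    (I : X₀.IdealSheafData) (_hri : IsRegularImmersionOfCodim I.subschemeι 2)
    (_hfr : ∀ x ∈ I.support, ∃ c : Fin 2 → X₀.presheaf.stalk x, Ideal.span (Set.range c) = stalkIdeal I x ∧ IsQuasiRegular c)
    (e : I.subscheme ≅ Y) (g : Y' ⟶ Y)
    (ψ : Y' ⟶ (I.comap j₀).subscheme) (hψiso : IsIso ψ) (hψ : ψ ≫ (I.comap j₀).subschemeι ≫ j₀ = g ≫ e.inv ≫ I.subschemeι)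
    (𝒟' : G₀.IdealSheafData) (hII' : I.comap j₀ * I.comap j₀ ≤ 𝒟') (_h𝒟'I : 𝒟' ≤ I.comap j₀)
    -- C1c's direction sections and DICTIONARY
    (U : Y' → Y'.Opens) (hU : ∀ p, p ∈ U p)
    (w : ∀ p, Γ((Scheme.Modules.pullback g).obj ((Scheme.Modules.pullback e.inv).obj (conormalSheaf I.subschemeι)), U p))
    (hDICT : ∀ p, ∃ (V : X₀.affineOpens) (x : Fin 2 → Γ(X₀, (V : X₀.Opens))) (s : Fin 2 → Γ(idealModule I.subschemeι, (V : X₀.Opens)))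
        (_ : RingTheory.Sequence.IsWeaklyRegular Γ(X₀, (V : X₀.Opens)) (List.ofFn x))
        (_ : Ideal.span (Set.range x) = I.ideal V)
        (_ : ∀ j, toRing (idealModuleι I.subschemeι) (V : X₀.Opens) (s j) = x j)
        (hUV : U p ≤ g ⁻¹ᵁ (e.inv ⁻¹ᵁ (I.subschemeι ⁻¹ᵁ (V : X₀.Opens))))
        (W : G₀.affineOpens) (hWV : (W : G₀.Opens) ≤ j₀ ⁻¹ᵁ (V : X₀.Opens))
        (hUW : U p ≤ (ψ ≫ (I.comap j₀).subschemeι) ⁻¹ᵁ (W : G₀.Opens))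
        (α : Fin 2 → Γ(G₀, (W : G₀.Opens))),
        w p = ∑ j, (ψ ≫ (I.comap j₀).subschemeι).appLE (W : G₀.Opens) (U p) hUW (α j) •
          ((Scheme.Modules.pullback g).obj ((Scheme.Modules.pullback e.inv).obj (conormalSheaf I.subschemeι))).presheaf.map
            (homOfLE hUV).op
            (unitSection g ((Scheme.Modules.pullback e.inv).obj (conormalSheaf I.subschemeι))
              (e.inv ⁻¹ᵁ (I.subschemeι ⁻¹ᵁ (V : X₀.Opens)))
              (unitSection e.inv (conormalSheaf I.subschemeι) (I.subschemeι ⁻¹ᵁ (V : X₀.Opens))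
                (unitSectionLE I.subschemeι (idealModule I.subschemeι) (le_refl (I.subschemeι ⁻¹ᵁ (V : X₀.Opens))) (s j)))) ∧
        𝒟'.ideal W = Ideal.span {∑ j, α j * j₀.appLE (V : X₀.Opens) (W : G₀.Opens) hWV (x j)} ⊔ ((I.comap j₀).ideal W) ^ 2)
    -- the line bundle `L₀ ↪ g^*F` generated by the `w p`, and the lift `σ` with `g^*σ = e'⁻¹ ≫ ι₀`
    (L₀ : Y'.Modules) (ι₀ : L₀ ⟶ (Scheme.Modules.pullback g).obj ((Scheme.Modules.pullback e.inv).obj (conormalSheaf I.subschemeι)))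
    (hι₀ : ∀ p, ∃ (φp : SheafOfModules.free (Fin 1) ≅ L₀.over (U p)) (u : Γ(Y', U p)), IsUnit u ∧
      ι₀.app (U p) (basisSection φp 0) = u • w p)
    (K : Y.Modules)
    (σ : K ⟶ (Scheme.Modules.pullback e.inv).obj (conormalSheaf I.subschemeι))
    (e' : L₀ ≅ (Scheme.Modules.pullback g).obj K) (hσ : (Scheme.Modules.pullback g).map σ = e'.inv ≫ ι₀)
    -- the package at a point
    (V : X₀.affineOpens) (x : Fin 2 → Γ(X₀, (V : X₀.Opens))) (s : Fin 2 → Γ(idealModule I.subschemeι, (V : X₀.Opens)))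
    (hgen : Ideal.span (Set.range x) = I.ideal V) (hs : ∀ j, toRing (idealModuleι I.subschemeι) (V : X₀.Opens) (s j) = x j)
    (eV : SheafOfModules.free (Fin 2) ≅ (conormalSheaf I.subschemeι).over (I.subschemeι ⁻¹ᵁ (V : X₀.Opens)))
    (heV : ∀ j, basisSection eV j = unitSectionLE I.subschemeι (idealModule I.subschemeι) (le_refl _) (s j))
    (A : Fin 2 → Γ(X₀, (V : X₀.Opens))) (W : Y.Opens) (κ : SheafOfModules.free (Fin 1) ≅ K.over W)
    (hVW : e.inv ⁻¹ᵁ (I.subschemeι ⁻¹ᵁ (V : X₀.Opens)) ≤ W)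
    (hlink : ((Scheme.Modules.pullback e.inv).obj (conormalSheaf I.subschemeι)).presheaf.map (homOfLE hVW).op
        (σ.app W (basisSection κ 0)) =
      ∑ j, e.inv.app _ (I.subschemeι.app (V : X₀.Opens) (A j)) •
        basisSection (E := (Scheme.Modules.pullback e.inv).obj (conormalSheaf I.subschemeι)) (pullbackFrame e.inv eV) j)
    (z : G₀) (hz : j₀ z ∈ (V : X₀.Opens)) :
    stalkIdeal 𝒟' z = Ideal.span {(j₀.stalkMap z).hom ((X₀.presheaf.germ (V : X₀.Opens) (j₀ z) hz).hom (∑ j, A j * x j))} ⊔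
      stalkIdeal (I.comap j₀) z ^ 2 := by
  classical
  -- notation
  let ιC := I.subschemeι
  let Ī := I.comap j₀
  let F : Y.Modules := (Scheme.Modules.pullback e.inv).obj (conormalSheaf I.subschemeι)
  let F' : Y'.Modules := (Scheme.Modules.pullback g).obj F
  let φ : Y' ⟶ G₀ := ψ ≫ (I.comap j₀).subschemeι
  haveI : IsIso ψ := hψiso
  haveI : IsClosedImmersion φ := inferInstance
  have hφ : φ ≫ j₀ = g ≫ e.inv ≫ I.subschemeι := by rw [Category.assoc]; exact hψ
  have hpt : ∀ q : Y', j₀ (φ q) = I.subschemeι (e.inv (g q)) := fun q => by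
    change (φ ≫ j₀) q = (g ≫ e.inv ≫ I.subschemeι) q
    rw [hφ]
  -- off the support of `Ī` both sides are `⊤`
  by_cases hzS : z ∈ (I.comap j₀).support
  swap
  · have hĪz : stalkIdeal (I.comap j₀) z = ⊤ := stalkIdeal_eq_top_of_not_mem_support hzS
    have h1 : stalkIdeal 𝒟' z = ⊤ := by
      rw [eq_top_iff]
      calc (⊤ : Ideal _) = stalkIdeal (I.comap j₀) z * stalkIdeal (I.comap j₀) z := by rw [hĪz, Ideal.top_mul]
        _ = stalkIdeal (I.comap j₀ * I.comap j₀) z := (stalkIdeal_mul _ _ _).symm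
        _ ≤ stalkIdeal 𝒟' z := stalkIdeal_mono hII' _
    rw [h1, hĪz, pow_two, Ideal.top_mul, sup_top_eq]
  -- on the support: `z = φ p`
  obtain ⟨p, rfl⟩ : ∃ p : Y', φ p = z := by
    have hz' : z ∈ Set.range (I.comap j₀).subschemeι := by
      rw [Scheme.IdealSheafData.range_subschemeι]; exact hzS
    obtain ⟨y, hy⟩ := hz'
    refine ⟨inv ψ y, ?_⟩
    change (inv ψ ≫ ψ ≫ (I.comap j₀).subschemeι) y = z
    rw [IsIso.inv_hom_id_assoc]
    exact hy
  -- the DICTIONARY at `p` and the frame of `ι₀` at `p`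
  obtain ⟨Vp, xp, sp, hregp, hgenp, hsp, hUVp, Wp, hWVp, hUWp, α, hw, h𝒟W⟩ := hDICT p
  obtain ⟨φp, u, hu, hιφ⟩ := hι₀ p
  have hpWp : φ p ∈ (Wp : G₀.Opens) := hUWp (hU p)
  have hxVp : j₀ (φ p) ∈ (Vp : X₀.Opens) := hWVp hpWp
  -- opens upstairs pulled back to `Y'`
  have hpGV : p ∈ (g ⁻¹ᵁ (e.inv ⁻¹ᵁ (I.subschemeι ⁻¹ᵁ (V : X₀.Opens)))) := by
    change I.subschemeι (e.inv (g p)) ∈ (V : X₀.Opens); rw [← hpt]; exact hz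
  have hgpW : g p ∈ W := hVW hpGV
  -- (d) `η_g(σ κ₀) = ι₀ (e'⁻¹ η_g κ₀)`
  let v : Γ(F, W) := σ.app W (basisSection κ 0)
  let t : Γ(L₀, g ⁻¹ᵁ W) := e'.inv.app (g ⁻¹ᵁ W) (unitSection g K W (basisSection κ 0))
  have hEq1 : unitSection g F W v = ι₀.app (g ⁻¹ᵁ W) t := by
    change unitSection g F W (σ.app W (basisSection κ 0)) =
      ι₀.app (g ⁻¹ᵁ W) (e'.inv.app (g ⁻¹ᵁ W) (unitSection g K W (basisSection κ 0)))
    rw [← pullback_map_app_unitSection g σ W, hσ, Scheme.Modules.Hom.comp_app]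
    rfl
  -- `t` is the basis section of a rank-one frame of `L₀` over `g⁻¹W`
  let ψ' : SheafOfModules.free (Fin 1) ≅ L₀.over (g ⁻¹ᵁ W) :=
    pullbackFrame g κ ≪≫ (SheafOfModules.overFunctor _ (g ⁻¹ᵁ W)).mapIso e'.symm
  have hψ't : basisSection ψ' 0 = t := by
    change basisSection (pullbackFrame g κ ≪≫ (SheafOfModules.overFunctor _ (g ⁻¹ᵁ W)).mapIso e'.symm) 0 = _
    rw [basisSection_trans_overIso, Functor.mapIso_hom, Iso.symm_hom, appLE_over_map, basisSection_pullbackFrame]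
  -- (e) on `(U p ⊓ g ⁻¹ᵁ W) := U p ⊓ g⁻¹W`: `t| = μ • bφ|` with `μ` a unit, hence `η_g(v)| = λ • (w p)|` with `λ` a unit
  have hpB : p ∈ (U p ⊓ g ⁻¹ᵁ W) := ⟨hU p, hgpW⟩
  let k₁ : (U p ⊓ g ⁻¹ᵁ W) ⟶ U p := homOfLE inf_le_left
  let k₂ : (U p ⊓ g ⁻¹ᵁ W) ⟶ g ⁻¹ᵁ W := homOfLE inf_le_right
  let μ : Γ(Y', (U p ⊓ g ⁻¹ᵁ W)) := coord φp k₁ (L₀.presheaf.map k₂.op t) 0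
  have hμ : IsUnit μ := by
    have h := isUnit_coord_of_frames φp ψ' k₁ k₂
    rwa [hψ't] at h
  have ht : L₀.presheaf.map k₂.op t = μ • L₀.presheaf.map k₁.op (basisSection φp 0) := by
    have h := eq_sum_coord_smul φp k₁ (L₀.presheaf.map k₂.op t)
    rwa [Fin.sum_univ_one] at h
  let lam : Γ(Y', (U p ⊓ g ⁻¹ᵁ W)) := μ * Y'.presheaf.map k₁.op u
  have hlam : IsUnit lam := hμ.mul (hu.map (Y'.presheaf.map k₁.op).hom)
  have hEq2 : F'.presheaf.map k₂.op (unitSection g F W v) = lam • F'.presheaf.map k₁.op (w p) := by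
    rw [hEq1, ← Scheme.Modules.Hom.app_map_apply, ht, Scheme.Modules.Hom.app_smul, Scheme.Modules.Hom.app_map_apply, hιφ,
      Scheme.Modules.map_smul, smul_smul]
  -- (f) a conormal frame for the DICTIONARY chart `(Vp, xp, sp)`
  have hspan' : Ideal.span (Set.range xp) = I.subschemeι.ker.ideal Vp := by
    rw [Scheme.IdealSheafData.ker_subschemeι]; exact hgenp
  obtain ⟨sp', b, hsp', hb⟩ := exists_basis_sections_pullback_idealModule_eq I.subschemeι Vp xp hregp hspan'
  have hss : sp' = sp := by
    funext j
    apply kernel_ι_app_injective (structureModuleMap I.subschemeι) (Vp : X₀.Opens)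
    change toRing (idealModuleι I.subschemeι) (Vp : X₀.Opens) (sp' j) = toRing (idealModuleι I.subschemeι) (Vp : X₀.Opens) (sp j)
    rw [hsp', hsp]
  obtain ⟨e₀⟩ := nonempty_free_iso_over_of_basis (conormalSheaf I.subschemeι) (coh_conormalSheaf I.subschemeι).loc
    (Vp.2.preimage I.subschemeι) b
  obtain ⟨eVp, heVp'⟩ := exists_frame_of_basis e₀ b
  have heVp : ∀ j, basisSection eVp j = unitSectionLE I.subschemeι (idealModule I.subschemeι) (le_refl _) (sp j) := fun j => by
    rw [heVp', ← hss]; exact hb j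
  -- (g) a common affine `V''` below `V ⊓ Vp` and the change of generators `xp = N x`
  obtain ⟨V'', h1, h2, hxV''⟩ : ∃ V'' : X₀.affineOpens,
      (V'' : X₀.Opens) ≤ V ∧ (V'' : X₀.Opens) ≤ Vp ∧ j₀ (φ p) ∈ (V'' : X₀.Opens) := by
    obtain ⟨V''o, hV''aff, hxV'', hV''le⟩ := exists_isAffineOpen_mem_and_subset
      (show j₀ (φ p) ∈ (V : X₀.Opens) ⊓ Vp from ⟨hz, hxVp⟩)
    exact ⟨⟨V''o, hV''aff⟩, fun _ h => (hV''le h).1, fun _ h => (hV''le h).2, hxV''⟩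
  obtain ⟨N, hN⟩ := exists_changeOfGenerators I h1 h2 x xp hgen hgenp
  have R3 := fun j => map_basisSection_eq_sum_of_changeOfGenerators I e.inv g h1 h2 x xp s sp hs hsp eV eVp heV heVp N hN j
  have hGV : (g ⁻¹ᵁ (e.inv ⁻¹ᵁ (I.subschemeι ⁻¹ᵁ (V'' : X₀.Opens)))) ≤ (g ⁻¹ᵁ (e.inv ⁻¹ᵁ (I.subschemeι ⁻¹ᵁ (V : X₀.Opens)))) := fun q hq => h1 hq
  have hGVp : (g ⁻¹ᵁ (e.inv ⁻¹ᵁ (I.subschemeι ⁻¹ᵁ (V'' : X₀.Opens)))) ≤ (g ⁻¹ᵁ (e.inv ⁻¹ᵁ (I.subschemeι ⁻¹ᵁ (Vp : X₀.Opens)))) := fun q hq => h2 hq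
  have hpGV'' : p ∈ (g ⁻¹ᵁ (e.inv ⁻¹ᵁ (I.subschemeι ⁻¹ᵁ (V'' : X₀.Opens)))) := by
    change I.subschemeι (e.inv (g p)) ∈ (V'' : X₀.Opens); rw [← hpt]; exact hxV''
  -- (h) the comparison open: the preimage `(φ ⁻¹ᵁ (W' : G₀.Opens)) := φ⁻¹W'` of an affine `W' ∋ φ p` below `Wp ⊓ j₀⁻¹V''`, inside `(U p ⊓ g ⁻¹ᵁ W) ⊓ (g ⁻¹ᵁ (e.inv ⁻¹ᵁ (I.subschemeι ⁻¹ᵁ (V'' : X₀.Opens))))`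
  obtain ⟨W', hpW', hW'le, hW'B⟩ := exists_affineOpen_preimage_le φ p ((U p ⊓ g ⁻¹ᵁ W) ⊓ (g ⁻¹ᵁ (e.inv ⁻¹ᵁ (I.subschemeι ⁻¹ᵁ (V'' : X₀.Opens))))) ⟨hpB, hpGV''⟩
    ((Wp : G₀.Opens) ⊓ j₀ ⁻¹ᵁ (V'' : X₀.Opens)) ⟨hpWp, hxV''⟩
  have kWp : (W' : G₀.Opens) ≤ Wp := fun _ h => (hW'le h).1
  have kWV'' : (W' : G₀.Opens) ≤ j₀ ⁻¹ᵁ (V'' : X₀.Opens) := fun _ h => (hW'le h).2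
  have kWV : (W' : G₀.Opens) ≤ j₀ ⁻¹ᵁ (V : X₀.Opens) := fun _ h => h1 ((hW'le h).2)
  have hpB' : p ∈ (φ ⁻¹ᵁ (W' : G₀.Opens)) := hpW'
  let kB : (φ ⁻¹ᵁ (W' : G₀.Opens)) ⟶ (U p ⊓ g ⁻¹ᵁ W) := homOfLE fun _ h => (hW'B h).1
  let kV'' : (φ ⁻¹ᵁ (W' : G₀.Opens)) ⟶ (g ⁻¹ᵁ (e.inv ⁻¹ᵁ (I.subschemeι ⁻¹ᵁ (V'' : X₀.Opens)))) := homOfLE fun _ h => (hW'B h).2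
  let kV : (φ ⁻¹ᵁ (W' : G₀.Opens)) ⟶ (g ⁻¹ᵁ (e.inv ⁻¹ᵁ (I.subschemeι ⁻¹ᵁ (V : X₀.Opens)))) := homOfLE fun _ h => hGV (hW'B h).2
  let bS : Fin 2 → Γ(F', (g ⁻¹ᵁ (e.inv ⁻¹ᵁ (I.subschemeι ⁻¹ᵁ (V : X₀.Opens))))) := fun l => basisSection (E := F') (pullbackFrame g (pullbackFrame e.inv eV)) l
  let bSp : Fin 2 → Γ(F', (g ⁻¹ᵁ (e.inv ⁻¹ᵁ (I.subschemeι ⁻¹ᵁ (Vp : X₀.Opens))))) := fun j => basisSection (E := F') (pullbackFrame g (pullbackFrame e.inv eVp)) j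
  let T : Fin 2 → Γ(F', (φ ⁻¹ᵁ (W' : G₀.Opens))) := fun l => F'.presheaf.map kV.op (bS l)
  let Â : Fin 2 → Γ(Y, (e.inv ⁻¹ᵁ (I.subschemeι ⁻¹ᵁ (V : X₀.Opens)))) := fun j => e.inv.app _ (I.subschemeι.app (V : X₀.Opens) (A j))
  let gA : Fin 2 → Γ(Y', (φ ⁻¹ᵁ (W' : G₀.Opens))) := fun l => Y'.presheaf.map kV.op (g.app (e.inv ⁻¹ᵁ (I.subschemeι ⁻¹ᵁ (V : X₀.Opens))) (Â l))
  let ν : Fin 2 → Fin 2 → Γ(Y', (φ ⁻¹ᵁ (W' : G₀.Opens))) := fun j l =>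
    Y'.presheaf.map kV''.op (g.app (e.inv ⁻¹ᵁ (I.subschemeι ⁻¹ᵁ (V'' : X₀.Opens))) (e.inv.app _ (I.subschemeι.app (V'' : X₀.Opens) (N j l))))
  let ab : Fin 2 → Γ(Y', (φ ⁻¹ᵁ (W' : G₀.Opens))) := fun j => Y'.presheaf.map (kB ≫ k₁).op (φ.appLE Wp (U p) hUWp (α j))
  -- (h-i) the `σ`-side: `η_g(v)|_{(φ ⁻¹ᵁ (W' : G₀.Opens))} = Σ_l gA_l • T_l`
  have hV1 : F'.presheaf.map (kB ≫ k₂).op (unitSection g F W v) = ∑ l, gA l • T l := by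
    have h0 : F.presheaf.map (homOfLE hVW).op v = ∑ l, Â l • F.presheaf.map (homOfLE (le_refl (e.inv ⁻¹ᵁ (I.subschemeι ⁻¹ᵁ (V : X₀.Opens))))).op
        (basisSection (E := F) (pullbackFrame e.inv eV) l) := by
      rw [show F.presheaf.map (homOfLE hVW).op v = ∑ j, Â j • basisSection (E := F) (pullbackFrame e.inv eV) j from hlink]
      refine Finset.sum_congr rfl fun l _ => ?_
      rw [Subsingleton.elim (homOfLE (le_refl (e.inv ⁻¹ᵁ (I.subschemeι ⁻¹ᵁ (V : X₀.Opens))))) (𝟙 (e.inv ⁻¹ᵁ (I.subschemeι ⁻¹ᵁ (V : X₀.Opens)))), presheaf_map_id]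
    have h := map_unitSection_eq_sum g F (homOfLE (le_refl (e.inv ⁻¹ᵁ (I.subschemeι ⁻¹ᵁ (V : X₀.Opens))))) (homOfLE hVW)
      (fun l => basisSection (E := F) (pullbackFrame e.inv eV) l) v Â h0
    rw [Literature.AlgebraicGeometry.Modules.presheaf_map_congr F' (kB ≫ k₂) (kV ≫ (Opens.map g.base).map (homOfLE hVW)), op_comp, F'.presheaf.map_comp]
    change F'.presheaf.map kV.op (F'.presheaf.map ((Opens.map g.base).map (homOfLE hVW)).op (unitSection g F W v)) = _
    rw [h, map_sum]
    refine Finset.sum_congr rfl fun l _ => ?_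
    rw [Scheme.Modules.map_smul, presheaf_map_map, ← basisSection_pullbackFrame g (pullbackFrame e.inv eV) l]
    exact congrArg _ (Literature.AlgebraicGeometry.Modules.presheaf_map_congr F' _ _ _)
  -- (h-ii) the `w`-side: `(w p)|_{(φ ⁻¹ᵁ (W' : G₀.Opens))} = Σ_j ab_j • Σ_l ν_jl • T_l`
  have hbSp : ∀ j, F'.presheaf.map (homOfLE hUVp).op (unitSection g F (e.inv ⁻¹ᵁ (I.subschemeι ⁻¹ᵁ (Vp : X₀.Opens)))
      (unitSection e.inv (conormalSheaf I.subschemeι) (I.subschemeι ⁻¹ᵁ (Vp : X₀.Opens))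
        (unitSectionLE I.subschemeι (idealModule I.subschemeι) (le_refl _) (sp j)))) =
      F'.presheaf.map (homOfLE hUVp).op (bSp j) := fun j => by
    change _ = F'.presheaf.map (homOfLE hUVp).op (basisSection (E := F') (pullbackFrame g (pullbackFrame e.inv eVp)) j)
    rw [basisSection_pullbackFrame, basisSection_pullbackFrame, heVp]
  have K2 : ∀ j, F'.presheaf.map (kB ≫ k₁ ≫ homOfLE hUVp).op (bSp j) = ∑ l, ν j l • T l := fun j => by
    rw [Literature.AlgebraicGeometry.Modules.presheaf_map_congr F' (kB ≫ k₁ ≫ homOfLE hUVp)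
      (kV'' ≫ (Opens.map g.base).map ((Opens.map e.inv.base).map ((Opens.map I.subschemeι.base).map (homOfLE h2)))),
      op_comp, F'.presheaf.map_comp]
    change F'.presheaf.map kV''.op (F'.presheaf.map _ (bSp j)) = _
    rw [R3 j, map_sum]
    refine Finset.sum_congr rfl fun l _ => ?_
    rw [Scheme.Modules.map_smul, presheaf_map_map]
    exact congrArg _ (Literature.AlgebraicGeometry.Modules.presheaf_map_congr F' _ _ _)
  have hV2 : F'.presheaf.map (kB ≫ k₁).op (w p) = ∑ j, ab j • ∑ l, ν j l • T l := by
    rw [hw, map_sum]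
    refine Finset.sum_congr rfl fun j _ => ?_
    rw [Scheme.Modules.map_smul, hbSp, presheaf_map_map, ← K2 j]
    rfl
  -- (h-iii) compare coefficients in the frame `pullbackFrame g (pullbackFrame e.inv eV)` over `(φ ⁻¹ᵁ (W' : G₀.Opens))`
  have KEY : ∀ m, gA m = Y'.presheaf.map kB.op lam * ∑ j, ab j * ν j m := by
    intro m
    have h := congrArg (fun r => F'.presheaf.map kB.op r) hEq2
    rw [presheaf_map_map, Scheme.Modules.map_smul, presheaf_map_map, hV1, hV2, Finset.smul_sum] at h
    simp_rw [Finset.smul_sum, smul_smul] at h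
    rw [Finset.sum_comm] at h
    simp_rw [← Finset.sum_smul] at h
    have hc := congrArg (fun r => coord (pullbackFrame g (pullbackFrame e.inv eV)) kV r m) h
    rw [coord_sum_smul_basisSection, coord_sum_smul_basisSection] at hc
    rw [hc, Finset.mul_sum]
  -- (j) descend to `G₀` along `(ψ ≫ ι_Ī)♯ : Γ(G₀, W') → Γ(Y', (φ ⁻¹ᵁ (W' : G₀.Opens)))` (onto, kernel `Ī(W')`)
  obtain ⟨Φ', hΦ'⟩ : ∃ Φ' : Γ(G₀, (W' : G₀.Opens)) →+* Γ(Y', (φ ⁻¹ᵁ (W' : G₀.Opens))), ∀ a, Φ' a = φ.appLE W' (φ ⁻¹ᵁ (W' : G₀.Opens)) le_rfl a :=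
    ⟨(φ.appLE W' (φ ⁻¹ᵁ (W' : G₀.Opens)) le_rfl).hom, fun _ => rfl⟩
  have hΦ'surj : Function.Surjective Φ' := by
    intro y
    have hs : Function.Surjective (φ.appLE W' (φ ⁻¹ᵁ (W' : G₀.Opens)) le_rfl) := by
      rw [Scheme.Hom.appLE_eq_app]; exact φ.app_surjective W' W'.2
    obtain ⟨a, ha⟩ := hs y
    exact ⟨a, (hΦ' a).trans ha⟩
  have hΦ'ker : ∀ a, Φ' a = 0 → a ∈ (I.comap j₀).ideal W' := fun a ha =>
    mem_ideal_of_appLE_comp_subschemeι_eq_zero (I.comap j₀) ψ W' ((hΦ' a).symm.trans ha)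
  -- restriction calculus
  have appLE_congr' : ∀ {f₁ f₂ : Y' ⟶ X₀}, f₁ = f₂ → ∀ (A : X₀.Opens) (B₀ : Y'.Opens) (e₁ : B₀ ≤ f₁ ⁻¹ᵁ A) (e₂ : B₀ ≤ f₂ ⁻¹ᵁ A)
      (t : Γ(X₀, A)), f₁.appLE A B₀ e₁ t = f₂.appLE A B₀ e₂ t := fun h => by subst h; intros; rfl
  have appLE_j₀ : ∀ {A : X₀.Opens} {A' : G₀.Opens} (hA : A' ≤ j₀ ⁻¹ᵁ A) {B₀ : Y'.Opens} (e' : B₀ ≤ φ ⁻¹ᵁ A')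
      (k : B₀ ⟶ g ⁻¹ᵁ (e.inv ⁻¹ᵁ (I.subschemeι ⁻¹ᵁ A))) (t : Γ(X₀, A)),
      φ.appLE A' B₀ e' (j₀.appLE A A' hA t) =
        Y'.presheaf.map k.op (g.app _ (e.inv.app _ (I.subschemeι.app A t))) := by
    intro A A' hA B₀ e' k t
    change (j₀.appLE A A' hA ≫ φ.appLE A' B₀ e') t = _
    rw [Scheme.Hom.appLE_comp_appLE, appLE_congr' hφ A B₀ _ k.le, Scheme.Hom.comp_appLE, Scheme.Hom.comp_app]
    rfl
  have appLE_res : ∀ {A A' : G₀.Opens} (hA : A' ≤ A) {B₀ B₁ : Y'.Opens} (k : B₁ ⟶ B₀) (e₀ : B₀ ≤ φ ⁻¹ᵁ A) (e₁ : B₁ ≤ φ ⁻¹ᵁ A')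
      (t : Γ(G₀, A)), Y'.presheaf.map k.op (φ.appLE A B₀ e₀ t) = φ.appLE A' B₁ e₁ (secRes G₀ hA t) := by
    intro A A' hA B₀ B₁ k e₀ e₁ t
    change (φ.appLE A B₀ e₀ ≫ Y'.presheaf.map k.op) t = (G₀.presheaf.map (homOfLE hA).op ≫ φ.appLE A' B₁ e₁) t
    rw [Scheme.Hom.appLE_map, Scheme.Hom.map_appLE]
  -- the three families of functions on `(φ ⁻¹ᵁ (W' : G₀.Opens))` come from `G₀`
  have S_A : ∀ l, gA l = Φ' (j₀.appLE (V : X₀.Opens) W' kWV (A l)) := fun l => by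
    have h := appLE_j₀ (A := (V : X₀.Opens)) kWV (le_refl (φ ⁻¹ᵁ (W' : G₀.Opens))) kV (A l)
    rw [hΦ', h]
  have S_N : ∀ j l, ν j l = Φ' (j₀.appLE (V'' : X₀.Opens) W' kWV'' (N j l)) := fun j l => by
    have h := appLE_j₀ (A := (V'' : X₀.Opens)) kWV'' (le_refl (φ ⁻¹ᵁ (W' : G₀.Opens))) kV'' (N j l)
    rw [hΦ', h]
  have S_α : ∀ j, ab j = Φ' (secRes G₀ kWp (α j)) := fun j => by
    rw [hΦ']; exact appLE_res kWp (kB ≫ k₁) hUWp le_rfl (α j)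
  -- a lift of the unit `λ` and of its inverse
  obtain ⟨lam', hlam'⟩ := hlam.exists_right_inv
  obtain ⟨lt, hlt⟩ := hΦ'surj (Y'.presheaf.map kB.op lam)
  obtain ⟨lt', hlt'⟩ := hΦ'surj (Y'.presheaf.map kB.op lam')
  have hlt1 : lt * lt' - 1 ∈ (I.comap j₀).ideal W' := by
    apply hΦ'ker
    rw [map_sub, map_mul, map_one, hlt, hlt', ← map_mul, hlam', map_one, sub_self]
  -- the congruences `j₀♯A_m ≡ lt · Σ_j α_j j₀♯N_jm (mod Ī(W'))`
  have hcong : ∀ m, j₀.appLE (V : X₀.Opens) W' kWV (A m) -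
      lt * ∑ j, secRes G₀ kWp (α j) * j₀.appLE (V'' : X₀.Opens) W' kWV'' (N j m) ∈ (I.comap j₀).ideal W' := by
    intro m
    apply hΦ'ker
    rw [map_sub, map_mul, map_sum, hlt, ← S_A, KEY m, sub_eq_zero]
    congr 1
    refine Finset.sum_congr rfl fun j _ => ?_
    rw [map_mul, ← S_N, ← S_α]
  -- (k) the ring endgame on `W'` and at the stalk of `φ p`
  have hxI : ∀ l, x l ∈ I.ideal V := fun l => by rw [← hgen]; exact Ideal.subset_span ⟨l, rfl⟩
  let xW : Fin 2 → Γ(G₀, (W' : G₀.Opens)) := fun l => j₀.appLE (V : X₀.Opens) W' kWV (x l)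
  have hxW : ∀ l, xW l ∈ (I.comap j₀).ideal W' := fun l => by
    change j₀.appLE (V : X₀.Opens) W' kWV (x l) ∈ _
    rw [ideal_comap_eq_map_of_le j₀ I V W' kWV]; exact Ideal.mem_map_of_mem _ (hxI l)
  let aW : Fin 2 → Γ(G₀, (W' : G₀.Opens)) := fun l => j₀.appLE (V : X₀.Opens) W' kWV (A l)
  let a'W : Fin 2 → Γ(G₀, (W' : G₀.Opens)) := fun l => ∑ j, secRes G₀ kWp (α j) * j₀.appLE (V'' : X₀.Opens) W' kWV'' (N j l)
  have hc : j₀.appLE (V : X₀.Opens) W' kWV (∑ j, A j * x j) = ∑ l, aW l * xW l := by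
    rw [map_sum]; exact Finset.sum_congr rfl fun l _ => map_mul _ _ _
  have hxpW : ∀ j, secRes G₀ kWp (j₀.appLE (Vp : X₀.Opens) Wp hWVp (xp j)) =
      ∑ l, j₀.appLE (V'' : X₀.Opens) W' kWV'' (N j l) * xW l := by
    intro j
    rw [secRes_appLE]
    have e1 : j₀.appLE (Vp : X₀.Opens) W' (kWp.trans hWVp) (xp j) = j₀.appLE (V'' : X₀.Opens) W' kWV'' (secRes X₀ h2 (xp j)) := by
      change _ = (X₀.presheaf.map (homOfLE h2).op ≫ j₀.appLE (V'' : X₀.Opens) W' kWV'') (xp j)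
      rw [Scheme.Hom.map_appLE]
    have e2 : ∀ l, xW l = j₀.appLE (V'' : X₀.Opens) W' kWV'' (secRes X₀ h1 (x l)) := fun l => by
      change j₀.appLE (V : X₀.Opens) W' kWV (x l) = (X₀.presheaf.map (homOfLE h1).op ≫ j₀.appLE (V'' : X₀.Opens) W' kWV'') (x l)
      rw [Scheme.Hom.map_appLE]
    rw [e1, hN j, map_sum]
    refine Finset.sum_congr rfl fun l _ => ?_
    rw [map_mul, e2]
  have hd : secRes G₀ kWp (∑ j, α j * j₀.appLE (Vp : X₀.Opens) Wp hWVp (xp j)) = ∑ l, a'W l * xW l := by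
    rw [map_sum]
    simp_rw [map_mul, hxpW, Finset.mul_sum, ← mul_assoc]
    rw [Finset.sum_comm]
    refine Finset.sum_congr rfl fun l _ => ?_
    rw [← Finset.sum_mul]
  have hDW : 𝒟'.ideal W' = Ideal.span {∑ l, a'W l * xW l} ⊔ ((I.comap j₀).ideal W') ^ 2 := by
    rw [← map_secRes_ideal 𝒟' kWp, h𝒟W, Ideal.map_sup, Ideal.map_pow, Ideal.map_span, Set.image_singleton,
      map_secRes_ideal _ kWp, hd]
  have hcd : (∑ l, aW l * xW l) - lt * ∑ l, a'W l * xW l ∈ ((I.comap j₀).ideal W') ^ 2 :=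
    sum_mul_sub_mul_sum_mul_mem_sq _ Finset.univ lt (fun l _ => hcong l) (fun l _ => hxW l)
  -- at the stalk
  let γ := (G₀.presheaf.germ (W' : G₀.Opens) (φ p) hpW').hom
  have hĪz : stalkIdeal (I.comap j₀) (φ p) = ((I.comap j₀).ideal W').map γ := stalkIdeal_eq_map_germ _ W' hpW'
  have hĪle : stalkIdeal (I.comap j₀) (φ p) ≤ maximalIdeal _ := (mem_support_iff_stalkIdeal_le _ _).mp hzS
  have hlt_unit : IsUnit (γ lt) := by
    refine isUnit_of_mul_sub_one_mem (stalkIdeal (I.comap j₀) (φ p)) hĪle (t' := γ lt') ?_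
    rw [hĪz, ← map_mul, ← map_one γ, ← map_sub]; exact Ideal.mem_map_of_mem _ hlt1
  have hD𝓏 : stalkIdeal 𝒟' (φ p) = Ideal.span {γ (∑ l, a'W l * xW l)} ⊔ stalkIdeal (I.comap j₀) (φ p) ^ 2 := by
    rw [stalkIdeal_eq_map_germ 𝒟' W' hpW', hDW, Ideal.map_sup, Ideal.map_span, Set.image_singleton, Ideal.map_pow, ← hĪz]
  have hgerm : (j₀.stalkMap (φ p)).hom ((X₀.presheaf.germ (V : X₀.Opens) (j₀ (φ p)) hz).hom (∑ j, A j * x j)) =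
      γ (∑ l, aW l * xW l) := by
    rw [← hc]
    change (j₀.stalkMap (φ p)) ((X₀.presheaf.germ (V : X₀.Opens) (j₀ (φ p)) hz) (∑ j, A j * x j)) =
      G₀.presheaf.germ (W' : G₀.Opens) (φ p) hpW' ((j₀.app (V : X₀.Opens) ≫ G₀.presheaf.map (homOfLE kWV).op) (∑ j, A j * x j))
    rw [Scheme.Hom.germ_stalkMap_apply, CategoryTheory.comp_apply, TopCat.Presheaf.germ_res_apply]
  have hcd' : γ (∑ l, aW l * xW l) - γ lt * γ (∑ l, a'W l * xW l) ∈ stalkIdeal (I.comap j₀) (φ p) ^ 2 := by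
    rw [hĪz, ← Ideal.map_pow, ← map_mul, ← map_sub]; exact Ideal.mem_map_of_mem _ hcd
  rw [hD𝓏, hgerm]
  exact (span_singleton_sup_sq_eq_of_sub_mul_mem _ hlt_unit hcd').symm

end Summit.ResolutionOfSingularities.ResolutionOfSingularities.Cruxes.EquisingularLiftNat.Sections

end
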